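import Summits.AtomisticToContinuum.HydrodynamicLimit.Theses.OneFlightGossipEngine
import Summits.AtomisticToContinuum.HydrodynamicLimit.Theorems.ImplosionDichotomyHydroLimitInBandWindowContinuity
import HarnessLib

/-!
# Window continuity of the relative entropy along the explicit reference family (crux `ClampedCurrentsDock`, stmt-14680, line `IdeatorTwoSketch`)

Registered stub `stub_windowContinuity : WindowContinuity` of the line skeleton `Cruxes/ClampedCurrentsDock/Lines/IdeatorTwoSketch.lean`:
the crude short-time continuity of `H_N` in band from the true-law inputs CAT, CEAT, ECT. The statement is byte-identical with the
in-band twin's registered `stub_windowContinuityInBand` (crux stmt-9133, line `IdeatorOneSketch`), LANDED by that lead in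
`Theorems/ImplosionDichotomyHydroLimitInBandWindowContinuity.lean`; this file reads it by name (one heart layer serves both cruxes).
prover-line-stmt-AtomisticToContinuum-14680-c2-0 (lead c2).
-/

noncomputable section

namespace Summit.AtomisticToContinuum.HydrodynamicLimit.Theorems.ClampedCurrentsDockWindowContinuity

open scoped BigOperators ENNReal Classical Interval
open MeasureTheory Filter Set Topology InformationTheory
open Literature.MathematicalPhysics.KineticTheory Literature.Analysis.FluidPDE Literature.Analysis.FunctionSpaces
open Summit.AtomisticToContinuum.HydrodynamicLimit.Theses.OneFlightGossipEngine (CollisionActivityTails EnergyCurrentTails)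
open Summit.AtomisticToContinuum.HydrodynamicLimit.Theorems
open Summit.AtomisticToContinuum.HydrodynamicLimit.Theorems.HydroLimitInBandContinuity (CollisionEnergyActivityTails
  WindowContinuityInBand stub_windowContinuityInBand)

/-- **Window continuity from the true-law inputs** (registered stub signature `stub_windowContinuity` of line `IdeatorTwoSketch`,
crux `ClampedCurrentsDock` — route-internal, not a cited fact; verbatim from the skeleton, 9133's registered
`stub_windowContinuityInBand` with the same signature). -/
def WindowContinuity : Prop :=
  CollisionActivityTails → CollisionEnergyActivityTails → EnergyCurrentTails → WindowContinuityInBand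

/-- **STUB `stub_windowContinuity : WindowContinuity`** of line `IdeatorTwoSketch` (crux `ClampedCurrentsDock`,
stmt-AtomisticToContinuum-14680): the in-band twin's landed theorem, read by name. [cite: Yau1991, §2] -/
theorem stub_windowContinuity : WindowContinuity :=
  stub_windowContinuityInBand

end Summit.AtomisticToContinuum.HydrodynamicLimit.Theorems.ClampedCurrentsDockWindowContinuity

end
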